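import Summits.ValiantsHypothesis.ValiantsHypothesis.Theorems.KPlusLogSqLawOctaveScalesClusters
import Summits.ValiantsHypothesis.ValiantsHypothesis.Theorems.KPlusLogSqLawOctaveRootNearBreakpoint

/-!
# Route «KPlusLogSqLaw», octave door — the NORM-ERA RUNG: octaves are paid for in bits of letter conditioning (no tropical hypothesis)

HONEST FRAMING.  Ideator seat val-idea-1 (g3, lens = control), `--supports stmt-ValiantsHypothesis-19561` (line «conditioning»,
`Cruxes/WeakLifting/Lines/conditioning.lean`, stub R1 `NormEraBound`).  `OctaveWeakLifting` (Ω-W, stmt-24457), `WeakLifting` (stmt-19561),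
`TropicalB`, Conjecture B are OPEN and untouched; this file is an UNCONDITIONAL rung about every real lacunary pencil; VP ≠ VNP is not moved.

THE RUNG (`normEra_octaveBound`).  Let `F = Σ_l X^{d_l} S_l` be a real `(m, K)` pencil with DISTINCT exponents whose letters carry sup-norm
conditioning certificates `a_l ‖v‖ ≤ ‖S_l v‖ ≤ 2^W a_l ‖v‖` (so `W ≥ log₂ κ_∞(S_l)`; no symmetry, no design hypothesis).  Then the nonzero
real roots of `det F` lie in at most `(2(W + ⌊log₂ K⌋ + 1) + 2)·K²` dyadic octaves.  Mechanism = the generalised Pellet / tropical-scaling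
exclusion of numerical linear algebra (Bini–Noferini–Sharify 2013; Noferini–Sharify–Tisseur 2015; Gaubert–Sharify 2009) counted in
octaves: at a root `x`, `F(x)v = 0` for some `v ≠ 0`; for the letter `i` whose NORM LINE `log₂(2^W a_i) + d_i θ` is on top at `θ = log₂|x|`,
`a_i |x|^{d_i} ‖v‖ ≤ ‖x^{d_i} S_i v‖ = ‖Σ_{l≠i} x^{d_l} S_l v‖ ≤ (K−1)·max_{l≠i} 2^W a_l |x|^{d_l} ‖v‖`, i.e. the top line is within
`W + log₂(K−1)` of a line of different slope, so (`envelopeGap`, integer slopes) `θ` is within that distance of a vertex of the K-line norm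
envelope (`root_near_normBreaks`); `cellCount_proof` turns confinement into the octave count.  Tight up to constants on K = 2 diagonal
staircases (Ω = m forces W ≈ m).  With `pencilDet_conj` (p594442) the certificate may be taken in any two-sided gauge `(G S_l H)_l`.

This file: `normCross`, `normBreaks`, `card_normBreaks_le`, `mem_normBreaks`, `sum_smul_mulVec`, `root_near_normBreaks`, `normEra_octaveBound`
(the statement of stub R1 `NormEraBound` of the line, verbatim after unfolding `CondLE`).
-/

set_option linter.dupNamespace false
set_option autoImplicit false

namespace Summit.ValiantsHypothesis.ValiantsHypothesis.Theorems.KPlusLogSqLaw.Octave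

open Polynomial Finset Matrix
open scoped BigOperators

section NormEra

variable {m K : ℕ}

/-- crossing abscissa (in `θ = log₂|x|`) of the norm lines `θ ↦ V k + d_k θ` of two letters. -/
noncomputable def normCross (d : Fin K → ℕ) (V : Fin K → ℝ) (kl : Fin K × Fin K) : ℝ :=
  (V kl.1 - V kl.2) / ((d kl.2 : ℝ) - d kl.1)

open scoped Classical in
/-- **norm breakpoints**: crossing abscissae of two letters with distinct exponents at which the first letter's norm line is on top of
the K-line norm envelope `θ ↦ max_l (V l + d_l θ)` (its vertices, seen from the `θ` side). -/
noncomputable def normBreaks (d : Fin K → ℕ) (V : Fin K → ℝ) : Finset ℝ :=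
  ((univ ×ˢ univ).filter (fun kl : Fin K × Fin K => d kl.1 ≠ d kl.2 ∧
      ∀ t, V t + (d t : ℝ) * normCross d V kl ≤ V kl.1 + (d kl.1 : ℝ) * normCross d V kl)).image (normCross d V)

/-- at most `K²` norm breakpoints (cheap count; the sharp count is `K − 1`). [folklore] -/
theorem card_normBreaks_le (d : Fin K → ℕ) (V : Fin K → ℝ) : (normBreaks d V).card ≤ K * K := by
  classical
  unfold normBreaks
  refine card_image_le.trans ((card_filter_le _ _).trans ?_)
  rw [card_product, card_univ, Fintype.card_fin]

/-- a tie point of two norm lines of distinct slopes with the first on top is a norm breakpoint. [folklore] -/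
theorem mem_normBreaks (d : Fin K → ℕ) (V : Fin K → ℝ) {b : ℝ} {k l : Fin K} (hkl : d k ≠ d l)
    (htie : V k + (d k : ℝ) * b = V l + (d l : ℝ) * b) (htop : ∀ t, V t + (d t : ℝ) * b ≤ V k + (d k : ℝ) * b) :
    b ∈ normBreaks d V := by
  classical
  have hne : ((d l : ℝ) - d k) ≠ 0 := by
    have : (d k : ℝ) ≠ d l := by exact_mod_cast hkl
    intro h; apply this; linarith
  have hb : normCross d V (k, l) = b := by
    unfold normCross
    rw [div_eq_iff hne]
    simp only
    linarith
  unfold normBreaks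
  rw [mem_image]
  refine ⟨(k, l), ?_, hb⟩
  rw [mem_filter]
  refine ⟨mem_product.2 ⟨mem_univ _, mem_univ _⟩, hkl, ?_⟩
  intro t
  rw [hb]
  exact htop t

/-- `(Σ_l c_l • S_l) v = Σ_l c_l • (S_l v)`. [folklore] -/
theorem sum_smul_mulVec (c : Fin K → ℝ) (S : Fin K → Matrix (Fin m) (Fin m) ℝ) (v : Fin m → ℝ) :
    (∑ l, c l • S l) *ᵥ v = ∑ l, c l • (S l *ᵥ v) := by
  rw [Matrix.sum_mulVec]
  refine Finset.sum_congr rfl fun l _ => ?_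
  rw [Matrix.smul_mulVec]

/-- **roots sit near norm breakpoints** (the exclusion step): with distinct exponents and conditioning certificates
`a_l‖v‖ ≤ ‖S_l v‖ ≤ 2^W a_l‖v‖`, every nonzero real root `x` of the pencil determinant has `log₂|x|` within `W + ⌊log₂ K⌋ + 1` of a
breakpoint of the norm envelope of the lines `θ ↦ log₂(2^W a_l) + d_l θ`. [this file; generalised Pellet exclusion] -/
theorem root_near_normBreaks (W : ℕ) (d : Fin K → ℕ) (S : Fin K → Matrix (Fin m) (Fin m) ℝ) (hd : Function.Injective d)
    (a : Fin K → ℝ) (ha : ∀ l, 0 < a l) (hlo : ∀ l (v : Fin m → ℝ), a l * ‖v‖ ≤ ‖S l *ᵥ v‖)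
    (hup : ∀ l (v : Fin m → ℝ), ‖S l *ᵥ v‖ ≤ 2 ^ W * a l * ‖v‖)
    (x : ℝ) (hx : x ≠ 0) (hp : pencilDet d S ≠ 0) (hroot : (pencilDet d S).IsRoot x) :
    ∃ b ∈ normBreaks d (fun l => Real.logb 2 (2 ^ W * a l)), |Real.logb 2 |x| - b| ≤ ((W + Nat.log 2 K + 1 : ℕ) : ℝ) := by
  classical
  -- K = 0: the determinant is a constant, so it has no roots
  rcases Nat.eq_zero_or_pos K with hK | hK
  · exfalso
    subst hK
    have hdet : ∃ c : ℝ, pencilDet d S = Polynomial.C c := by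
      unfold pencilDet
      rw [Finset.univ_eq_empty, Finset.sum_empty]
      rcases Nat.eq_zero_or_pos m with hm | hm
      · subst hm
        exact ⟨1, by rw [Matrix.det_isEmpty, map_one]⟩
      · haveI : Nonempty (Fin m) := ⟨⟨0, hm⟩⟩
        exact ⟨0, by rw [Matrix.det_zero, map_zero]⟩
    obtain ⟨c, hc⟩ := hdet
    have h0 : (pencilDet d S).eval x = 0 := hroot
    rw [hc, eval_C] at h0
    apply hp
    rw [hc, h0, map_zero]
  haveI : Nonempty (Fin K) := ⟨⟨0, hK⟩⟩
  -- a kernel vector at the root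
  have hdet : Matrix.det (∑ l, x ^ d l • S l) = 0 := by
    have h0 : (pencilDet d S).eval x = 0 := hroot
    rwa [eval_pencilDet] at h0
  obtain ⟨v, hv0, hv⟩ := Matrix.exists_mulVec_eq_zero_iff.2 hdet
  have hvpos : 0 < ‖v‖ := norm_pos_iff.2 hv0
  set y : ℝ := |x| with hy
  have hypos : 0 < y := abs_pos.2 hx
  -- multiplicative line values
  set b : Fin K → ℝ := fun l => 2 ^ W * a l with hb
  have hbpos : ∀ l, 0 < b l := fun l => by simp only [hb]; exact mul_pos (by positivity) (ha l)
  set f : Fin K → ℝ := fun l => y ^ d l * b l with hf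
  have hfpos : ∀ l, 0 < f l := fun l => mul_pos (pow_pos hypos _) (hbpos l)
  obtain ⟨i, -, hi⟩ := Finset.exists_max_image univ f univ_nonempty
  -- isolate the dominant letter's term
  rw [sum_smul_mulVec] at hv
  have hsplit := Finset.add_sum_erase univ (fun l => x ^ d l • (S l *ᵥ v)) (mem_univ i)
  rw [hv] at hsplit
  have hiso : x ^ d i • (S i *ᵥ v) = -∑ l ∈ univ.erase i, x ^ d l • (S l *ᵥ v) := by
    rw [eq_neg_iff_add_eq_zero]; exact hsplit
  -- norms
  have hleft : y ^ d i * (a i * ‖v‖) ≤ ‖x ^ d i • (S i *ᵥ v)‖ := by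
    rw [norm_smul, norm_pow, Real.norm_eq_abs]
    exact mul_le_mul_of_nonneg_left (hlo i v) (pow_pos hypos _).le
  have hright : ‖x ^ d i • (S i *ᵥ v)‖ ≤ ∑ l ∈ univ.erase i, f l * ‖v‖ := by
    rw [hiso, norm_neg]
    refine (norm_sum_le _ _).trans (Finset.sum_le_sum fun l _ => ?_)
    rw [norm_smul, norm_pow, Real.norm_eq_abs]
    calc y ^ d l * ‖S l *ᵥ v‖ ≤ y ^ d l * (2 ^ W * a l * ‖v‖) := mul_le_mul_of_nonneg_left (hup l v) (pow_pos hypos _).le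
      _ = f l * ‖v‖ := by simp only [hf, hb]; ring
  -- the runner-up letter
  rcases (univ.erase i).eq_empty_or_nonempty with he | hne
  · exfalso
    rw [he, Finset.sum_empty] at hright
    have : 0 < y ^ d i * (a i * ‖v‖) := mul_pos (pow_pos hypos _) (mul_pos (ha i) hvpos)
    linarith
  obtain ⟨j, hj, hjmax⟩ := Finset.exists_max_image (univ.erase i) f hne
  have hji : j ≠ i := (mem_erase.1 hj).1
  have hdij : d i ≠ d j := fun h => hji (hd h).symm
  have hcard : ((univ.erase i).card : ℝ) ≤ K := by
    have : (univ.erase i).card ≤ K := (card_erase_le).trans (by rw [card_univ, Fintype.card_fin])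
    exact_mod_cast this
  have hK1 : (1 : ℝ) ≤ K := by exact_mod_cast hK
  have hsum : ∑ l ∈ univ.erase i, f l * ‖v‖ ≤ K * (f j * ‖v‖) :=
    calc ∑ l ∈ univ.erase i, f l * ‖v‖ ≤ ∑ _l ∈ univ.erase i, f j * ‖v‖ :=
          Finset.sum_le_sum fun l hl => mul_le_mul_of_nonneg_right (hjmax l hl) hvpos.le
      _ = (univ.erase i).card * (f j * ‖v‖) := by rw [Finset.sum_const, nsmul_eq_mul]
      _ ≤ K * (f j * ‖v‖) := mul_le_mul_of_nonneg_right hcard (mul_pos (hfpos j) hvpos).le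
  -- the key multiplicative inequality: f i ≤ 2^W · K · f j
  have hkey : f i ≤ 2 ^ W * K * f j := by
    have h1 : y ^ d i * (a i * ‖v‖) ≤ K * (f j * ‖v‖) := hleft.trans (hright.trans hsum)
    have h2 : y ^ d i * a i ≤ K * f j := by
      have := div_le_div_of_nonneg_right h1 hvpos.le
      rw [show y ^ d i * (a i * ‖v‖) / ‖v‖ = y ^ d i * a i by field_simp,
        show K * (f j * ‖v‖) / ‖v‖ = K * f j by field_simp] at this
      exact this
    calc f i = 2 ^ W * (y ^ d i * a i) := by simp only [hf, hb]; ring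
      _ ≤ 2 ^ W * (K * f j) := mul_le_mul_of_nonneg_left h2 (by positivity)
      _ = 2 ^ W * K * f j := by ring
  -- pass to logarithms: the norm lines
  set θ : ℝ := Real.logb 2 y with hθ
  set V : Fin K → ℝ := fun l => Real.logb 2 (b l) with hV
  have hline : ∀ l, Real.logb 2 (f l) = V l + (d l : ℝ) * θ := by
    intro l
    simp only [hf, hV, hθ]
    rw [Real.logb_mul (pow_pos hypos _).ne' (hbpos l).ne', Real.logb_pow]
    ring
  have htop : ∀ k, V k + (((d k : ℤ)) : ℝ) * θ ≤ V i + (((d i : ℤ)) : ℝ) * θ := by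
    intro k
    push_cast
    rw [← hline, ← hline]
    exact Real.logb_le_logb_of_le one_lt_two (hfpos k) (hi k (mem_univ k))
  set c : ℝ := ((W + Nat.log 2 K + 1 : ℕ) : ℝ) with hc
  have hlogK : Real.logb 2 (K : ℝ) ≤ (Nat.log 2 K : ℝ) + 1 := by
    have hlt : (K : ℝ) < (2 : ℝ) ^ (Nat.log 2 K + 1) := by exact_mod_cast Nat.lt_pow_succ_log_self one_lt_two K
    have := Real.logb_le_logb_of_le one_lt_two (by exact_mod_cast hK) hlt.le
    rw [Real.logb_pow, Real.logb_self_eq_one one_lt_two, mul_one] at this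
    push_cast at this
    exact this
  have hnear : V i + (((d i : ℤ)) : ℝ) * θ ≤ V j + (((d j : ℤ)) : ℝ) * θ + c := by
    push_cast
    rw [← hline, ← hline]
    have h1 : Real.logb 2 (f i) ≤ Real.logb 2 (2 ^ W * K * f j) :=
      Real.logb_le_logb_of_le one_lt_two (hfpos i) hkey
    have h2 : Real.logb 2 (2 ^ W * K * f j) = W + Real.logb 2 K + Real.logb 2 (f j) := by
      rw [Real.logb_mul (by positivity) (hfpos j).ne', Real.logb_mul (by positivity) (by positivity),
        Real.logb_pow, Real.logb_self_eq_one one_lt_two, mul_one]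
    rw [h2] at h1
    have h3 : (W : ℝ) + Real.logb 2 K ≤ c := by rw [hc]; push_cast; linarith
    linarith
  have hij : ((d i : ℤ)) ≠ ((d j : ℤ)) := by exact_mod_cast hdij
  obtain ⟨b₀, hb₀, k, l, hkl, htie, hall⟩ := envelopeGap (fun l => (d l : ℤ)) V c θ i j hij htop hnear
  refine ⟨b₀, ?_, ?_⟩
  · have hkl' : d k ≠ d l := fun h => hkl (by simp [h])
    refine mem_normBreaks d V hkl' ?_ ?_
    · have := htie; push_cast at this; exact this
    · intro t; have := hall t; push_cast at this; exact this
  · exact hb₀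

/-- **THE NORM-ERA RUNG** (statement of stub R1 `NormEraBound` of line «conditioning», unfolded): distinct exponents and
`2^W`-conditioned letters ⇒ the nonzero real roots of the pencil determinant occupy at most `(2(W + ⌊log₂ K⌋ + 1) + 2)·K²` octaves.
No tropical hypothesis, no symmetry. [this file] -/
theorem normEra_octaveBound (m K W : ℕ) (d : Fin K → ℕ) (S : Fin K → Matrix (Fin m) (Fin m) ℝ) (hd : Function.Injective d)
    (hc : ∀ l, ∃ a : ℝ, 0 < a ∧ (∀ v : Fin m → ℝ, a * ‖v‖ ≤ ‖S l *ᵥ v‖) ∧ (∀ v : Fin m → ℝ, ‖S l *ᵥ v‖ ≤ 2 ^ W * a * ‖v‖)) :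
    octaveCount (pencilDet d S) ≤ (2 * (W + Nat.log 2 K + 1) + 2) * (K * K) := by
  choose a ha hlo hup using hc
  have h := cellCount_proof (pencilDet d S) (normBreaks d (fun l => Real.logb 2 (2 ^ W * a l))) (W + Nat.log 2 K + 1)
    (fun x hx hp hr => root_near_normBreaks W d S hd a ha hlo hup x hx hp hr)
  exact h.trans (Nat.mul_le_mul_left _ (card_normBreaks_le _ _))

end NormEra

end Summit.ValiantsHypothesis.ValiantsHypothesis.Theorems.KPlusLogSqLaw.Octave
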